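import Literature.NumberTheory.LFunctions.SiegelZeroExceptionalPrimesProofs
import Literature.NumberTheory.LFunctions.SiegelZeroHarmonicWeight
import HarnessLib

/-!
# Proof of Tao–Teräväinen's Proposition 3.5, second bound (3.14), and of Corollary 3.6 (i):
# `∑_{q^{(1+ε)/(2m)} < p* ≤ q^{(1+ε)/(2(m-1))}} 1/p* ≪_ε m η^{-1/m}`

Topic `Literature/NumberTheory/LFunctions`, namespace `SiegelZero`. Everything in this file is
PROVED (theorems only). The main results DISCHARGE the two remaining named facts of
`SiegelZeroExceptionalPrimes.lean` (Tao–Teräväinen, *The Hardy–Littlewood–Chowla conjecture in the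
presence of a Siegel zero*, J. London Math. Soc. (2) 106 (2022), arXiv:2109.06291):

* `TaoTeravainen2021_eq314_holds : TaoTeravainen2021_eq314` — Proposition 3.5, second bound
  (arXiv (3.14) = JLMS (3.23)), for an arbitrary primitive quadratic character;
* `TaoTeravainen2021_cor36_i_holds : TaoTeravainen2021_cor36_i` — Corollary 3.6, first bound,
  assembled from `TaoTeravainen2021_cor36_i_of_prop35` (same file as the facts),
  `TaoTeravainen2021_eq313_holds` (`SiegelZeroExceptionalPrimesProofs.lean`) and the above.

## The printed proof of (3.14) and what is proved here (§3.3, p. 11 of the arXiv version)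

"In a similar vein, we have for any natural number `m ≥ 2` that
`∑_{q^{(1+ε)/2} < n ≤ q^{10}} (1∗χ)(n)/n ≥ ∑_{n < q^{(1+ε)/2}} (1∗χ)(n)/n ·
  ∑_{q^{(1+ε)/(2m)} < p₁* < … < p_m* ≤ q^{(1+ε)/(2(m-1))} : p₁*, …, p_m* ∤ n} 1/(p₁* ⋯ p_m*)`
… Observe that once `n < q^{(1+ε)/2}` and some of the exceptional primes `p₁*, …, p_j*`, `j < m`
have been chosen, the restrictions that the exceptional prime `p_{j+1}*` be distinct from
`p₁*, …, p_j*` and not divide `n` only excludes at most `2m` primes … since `n` has at most `m`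
factors in this range. Thus [the inner sum is at least `(∑* 1/p*)^m/m!`, the asterisk meaning
the `2m` largest terms may be deleted]. The estimates (3.15), (3.16) then give
`∑* 1/p* ≪_ε (m! L(1,χ) log q/(L(1,χ) η log q))^{1/m} ≪ m η^{-1/m}`. One can reinstate the top
`2m` terms … since their contribution is `≪ m/q^{1/(2m)} ≪ m η^{-1/m}` by the Siegel bound (1.4).
The claim (3.14) follows." [cite: TaoTeravainen2021, §3.3 proof of Proposition 3.5 (3.14)]

The Lean proof follows this architecture with the weight `g(n) = (1∗χ)(n)/n` (multiplicative,
`≥ 0`, `g(p*) ≥ 1/p*` at exceptional primes, `g(p) ≤ 2/p`; `SiegelZeroHarmonicWeight.lean`), the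
window `R` of ALL primes in `(q^{(1+ε)/(2m)}, q^{(1+ε)/(2(m-1))}]`, `Y = ⌊q^{(1+ε)/2}⌋` and
`U = Y ⌊q^{(1+ε)/(2(m-1))}⌋^m` (in place of `q^{10}`, which only works for `ε ≤ 17/3`):

1. `card_filter_dvd_le` — an integer `N < (a+1)^{k+1}` has at most `k` prime factors `> a`
   ("`n` has at most `m` factors in this range"; here: `n ≤ Y` has `≤ m - 1`, `N ≤ U` has
   `≤ 2m + 1` prime factors from the window);
2. `sum_mul_esymm_filter_le` — **the first display made rigorous.** The map
   `(n, {p₁, …, p_m}) ↦ n p₁ ⋯ p_m` (`pᵢ ∈ R` distinct, `pᵢ ∤ n`) is NOT injective as the printed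
   display implicitly uses (e.g. `(p′k){p} = (pk){p′}`), but its fibre over `N` injects into the
   subsets of the `≤ k` primes of `R` dividing `N`; hence
   `∑_{n ≤ Y} g(n) e_m(g; R ∖ {p ∣ n}) ≤ 2^k ∑_{Y < N ≤ U} g(N)` — a harmless factor `2^{2m+1}`,
   since only its `m`-th root enters;
3. `pow_sub_le_factorial_mul_esymm_filter` — "delete at most `2m` terms":
   `(S - (j + m - 1) w_max)^m ≤ m! e_m(g; R ∖ D)` whenever `|D| ≤ j`, for weights
   `0 ≤ w ≤ w_max` with sum `S` (from the tree's `pow_le_factorial_mul_esymm`);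
4. `le_of_pow_sub_le` — `(S - c)^m ≤ m! ρ ⇒ S ≤ m ρ^{1/m} + c`;
5. the analytic input is the tree's engine `exists_harmSum_ratio_le` ((3.12), (3.15), (3.16):
   `(G(U) - G(Y)) η log q ≤ 4 (log U - log Y + 2) G(Y)`, `G(N) = ∑_{n ≤ N} g(n)`), used with
   `ε/2` (so that the integer `Y = ⌊q^{(1+ε)/2}⌋ ≥ q^{(1+ε/2)/2}` qualifies once `q ≥ 2^{4/ε}`,
   which large `η` forces: `exists_le_conductor`), and `log U - log Y ≤ (1+ε) log q`;
6. "reinstating the top terms": `w_max = 2/(⌊q^{(1+ε)/(2m)}⌋ + 1) ≤ 2 η^{-1/m}` because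
   `η ≤ q^{1/2}` for large `η` (`exists_eta_le_rpow`, the Siegel bound (1.4)).

The constant obtained is `K = 32(4+ε) + 4`; `η₀` depends on `ε` ineffectively (Siegel), exactly
as the source's conventions (§2.1) allow.

## References

* T. Tao, J. Teräväinen, *The Hardy–Littlewood–Chowla conjecture in the presence of a Siegel
  zero*, J. London Math. Soc. (2) 106 (2022) 3317–3378, Proposition 3.5 (3.14) and its proof,
  Corollary 3.6. arXiv:2109.06291. [TaoTeravainen2021]
-/

noncomputable section

open Finset ArithmeticFunction

namespace Literature.NumberTheory.LFunctions.SiegelZero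

/-! ### Integers with few large prime factors -/

/-- **"`n` has at most `m` factors in this range"**: if every prime of `R` exceeds `a` and
`1 ≤ N < (a+1)^{k+1}`, then at most `k` primes of `R` divide `N` (their product divides `N`).
[cite: TaoTeravainen2021, §3.3 proof of Proposition 3.5 (3.14)] -/
theorem card_filter_dvd_le {R : Finset ℕ} (hR : ∀ p ∈ R, p.Prime) {a k N : ℕ}
    (ha : ∀ p ∈ R, a < p) (hN : 1 ≤ N) (hNk : N < (a + 1) ^ (k + 1)) :
    (R.filter (· ∣ N)).card ≤ k := by
  classical
  by_contra hlt
  rw [not_le] at hlt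
  set D := R.filter (· ∣ N) with hD
  have hdvd : ∏ p ∈ D, p ∣ N := Finset.prod_primes_dvd N
    (fun p hp => (hR p (Finset.mem_filter.mp hp).1).prime)
    (fun p hp => (Finset.mem_filter.mp hp).2)
  have hle : ∏ p ∈ D, p ≤ N := Nat.le_of_dvd (by omega) hdvd
  have hpow : (a + 1) ^ D.card ≤ ∏ p ∈ D, p :=
    Finset.pow_card_le_prod D (fun p => p) (a + 1)
      (fun p hp => Nat.succ_le_of_lt (ha p (Finset.mem_filter.mp hp).1))
  have hmono : (a + 1) ^ (k + 1) ≤ (a + 1) ^ D.card :=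
    Nat.pow_le_pow_right (Nat.succ_pos a) hlt
  have : (a + 1) ^ (k + 1) < (a + 1) ^ (k + 1) :=
    calc (a + 1) ^ (k + 1) ≤ (a + 1) ^ D.card := hmono
      _ ≤ ∏ p ∈ D, p := hpow
      _ ≤ N := hle
      _ < (a + 1) ^ (k + 1) := hNk
  exact lt_irrefl _ this

/-! ### `m`-fold products with primes not dividing `n`: bounded fibres -/

variable {g : ArithmeticFunction ℝ}

/-- **The `m`-fold products, fibre-counted** (rigorous form of the first display in the proof
of (3.14)): let `g ≥ 0` be multiplicative, `R` a finite set of primes and `m, Y, U, k` such that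
every `m`-subset `P ⊆ R` has `∏ P > Y` and `n ∏ P ≤ U` for `n ≤ Y`, and every `N ∈ (Y, U]` is
divisible by at most `k` primes of `R`. Then
`∑_{n ≤ Y} g(n) · ∑_{P ⊆ {p ∈ R : p ∤ n}, |P| = m} ∏_{p ∈ P} g(p) ≤ 2^k ∑_{Y < N ≤ U} g(N)`:
`g(n ∏ P) = g(n) ∏ g(p)` by coprimality, and the fibre of `(n, P) ↦ n ∏ P` over `N` injects
(via `P`) into the subsets of the primes of `R` dividing `N`.
[cite: TaoTeravainen2021, §3.3 proof of Proposition 3.5 (3.14)] -/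
theorem sum_mul_esymm_filter_le (hg : g.IsMultiplicative) (hg0 : ∀ n, 0 ≤ g n)
    {R : Finset ℕ} (hR : ∀ p ∈ R, p.Prime) {m Y U k : ℕ}
    (hlow : ∀ P ∈ R.powersetCard m, Y < ∏ p ∈ P, p)
    (hup : ∀ n ∈ Icc 1 Y, ∀ P ∈ R.powersetCard m, n * ∏ p ∈ P, p ≤ U)
    (hfew : ∀ N ∈ Ioc Y U, (R.filter (· ∣ N)).card ≤ k) :
    ∑ n ∈ Icc 1 Y, g n * ∑ P ∈ (R.filter fun p => ¬ p ∣ n).powersetCard m, ∏ p ∈ P, g p ≤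
      2 ^ k * ∑ N ∈ Ioc Y U, g N := by
  classical
  -- the index set of pairs `(n, P)` and the product map
  set T := (Icc 1 Y).sigma fun n => (R.filter fun p => ¬ p ∣ n).powersetCard m with hT
  set F : (Σ _ : ℕ, Finset ℕ) → ℕ := fun x => x.1 * ∏ p ∈ x.2, p with hF
  have hmem : ∀ x ∈ T, (1 ≤ x.1 ∧ x.1 ≤ Y) ∧ x.2 ⊆ R ∧ (∀ p ∈ x.2, ¬ p ∣ x.1) ∧
      x.2.card = m := by
    rintro ⟨n, P⟩ hx
    simp only [hT, Finset.mem_sigma, Finset.mem_Icc, Finset.mem_powersetCard] at hx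
    obtain ⟨hn, hPR, hcard⟩ := hx
    exact ⟨hn, fun p hp => (Finset.mem_filter.mp (hPR hp)).1,
      fun p hp => (Finset.mem_filter.mp (hPR hp)).2, hcard⟩
  -- the left-hand side as a sum over `T`
  have hLHS : ∑ n ∈ Icc 1 Y, g n * ∑ P ∈ (R.filter fun p => ¬ p ∣ n).powersetCard m,
      ∏ p ∈ P, g p = ∑ x ∈ T, g x.1 * ∏ p ∈ x.2, g p := by
    rw [hT, Finset.sum_sigma]
    refine Finset.sum_congr rfl fun n _ => ?_
    rw [Finset.mul_sum]
  -- `g(n) ∏ g(p) = g(n ∏ P)`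
  have hval : ∀ x ∈ T, g x.1 * ∏ p ∈ x.2, g p = g (F x) := by
    intro x hx
    obtain ⟨-, hPR, hnd, -⟩ := hmem x hx
    have hPprime : ∀ p ∈ x.2, p.Prime := fun p hp => hR p (hPR hp)
    have hcop : Nat.Coprime x.1 (∏ p ∈ x.2, p) :=
      Nat.Coprime.prod_right fun p hp => Nat.Coprime.symm
        ((Nat.Prime.coprime_iff_not_dvd (hPprime p hp)).mpr (hnd p hp))
    simp only [hF]
    rw [hg.map_mul_of_coprime hcop, hg.map_prod_of_prime _ hPprime]
  -- the products land in `(Y, U]`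
  have hmaps : ∀ x ∈ T, F x ∈ Ioc Y U := by
    intro x hx
    obtain ⟨hn, hPR, -, hcard⟩ := hmem x hx
    have hP : x.2 ∈ R.powersetCard m := Finset.mem_powersetCard.mpr ⟨hPR, hcard⟩
    rw [Finset.mem_Ioc]
    constructor
    · calc Y < ∏ p ∈ x.2, p := hlow _ hP
        _ ≤ x.1 * ∏ p ∈ x.2, p := Nat.le_mul_of_pos_left _ hn.1
    · exact hup x.1 (Finset.mem_Icc.mpr hn) _ hP
  -- each fibre has at most `2^k` elements
  have hfib : ∀ N ∈ Ioc Y U, ((T.filter fun x => F x = N).card : ℝ) ≤ 2 ^ k := by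
    intro N hN
    have h1 : (T.filter fun x => F x = N).card ≤ ((R.filter (· ∣ N)).powerset).card := by
      refine Finset.card_le_card_of_injOn (fun x => x.2) ?_ ?_
      · intro x hx
        rw [Finset.coe_filter] at hx
        obtain ⟨hxT, hxN⟩ := hx
        obtain ⟨-, hPR, -, -⟩ := hmem x hxT
        rw [Finset.mem_coe, Finset.mem_powerset]
        intro p hp
        rw [Finset.mem_filter]
        refine ⟨hPR hp, ?_⟩
        rw [← hxN]
        exact Dvd.dvd.mul_left (Finset.dvd_prod_of_mem _ hp) _
      · rintro ⟨n, P⟩ hx ⟨n', P'⟩ hy hPP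
        rw [Finset.coe_filter] at hx hy
        change P = P' at hPP
        subst hPP
        obtain ⟨-, hPR, -, -⟩ := hmem _ hx.1
        have hprod : 0 < ∏ p ∈ P, p := Finset.prod_pos fun p hp => (hR p (hPR hp)).pos
        have h : n * ∏ p ∈ P, p = n' * ∏ p ∈ P, p := hx.2.trans hy.2.symm
        have hnn' : n = n' := Nat.eq_of_mul_eq_mul_right hprod h
        subst hnn'
        rfl
    have h2 : ((R.filter (· ∣ N)).powerset).card ≤ 2 ^ k := by
      rw [Finset.card_powerset]
      exact Nat.pow_le_pow_right (by norm_num) (hfew N hN)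
    exact_mod_cast h1.trans h2
  calc ∑ n ∈ Icc 1 Y, g n * ∑ P ∈ (R.filter fun p => ¬ p ∣ n).powersetCard m, ∏ p ∈ P, g p
      = ∑ x ∈ T, g (F x) := by rw [hLHS]; exact Finset.sum_congr rfl hval
    _ = ∑ N ∈ Ioc Y U, ∑ _x ∈ T.filter (fun x => F x = N), g N :=
        (Finset.sum_fiberwise_of_maps_to' hmaps _).symm
    _ = ∑ N ∈ Ioc Y U, ((T.filter fun x => F x = N).card : ℝ) * g N := by
        refine Finset.sum_congr rfl fun N _ => ?_
        rw [Finset.sum_const, nsmul_eq_mul]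
    _ ≤ ∑ N ∈ Ioc Y U, 2 ^ k * g N :=
        Finset.sum_le_sum fun N hN => mul_le_mul_of_nonneg_right (hfib N hN) (hg0 N)
    _ = 2 ^ k * ∑ N ∈ Ioc Y U, g N := by rw [Finset.mul_sum]

/-! ### Elementary symmetric means with deleted terms -/

/-- **"Deleting at most `2m` terms"**: for weights `0 ≤ w_p ≤ w_max` on `R` with sum `S`, a
predicate `f` holding on at most `j` elements of `R`, and `S ≥ (j + m - 1) w_max`:
`(S - (j + m - 1) w_max)^m ≤ m! · e_m(w; {p ∈ R : ¬ f p})` (the weight outside `f` has sum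
`≥ S - j w_max`; then the tree's `pow_le_factorial_mul_esymm`).
[cite: TaoTeravainen2021, §3.3 proof of Proposition 3.5 (3.14)] -/
theorem pow_sub_le_factorial_mul_esymm_filter {R : Finset ℕ} {w : ℕ → ℝ} {wmax : ℝ}
    (hw0 : ∀ p ∈ R, 0 ≤ w p) (hwm : ∀ p ∈ R, w p ≤ wmax) (hwmax : 0 ≤ wmax)
    (f : ℕ → Prop) [DecidablePred f] {m j : ℕ} (hj : (R.filter f).card ≤ j)
    (hS : ((j : ℝ) + ((m : ℝ) - 1)) * wmax ≤ ∑ p ∈ R, w p) :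
    ((∑ p ∈ R, w p) - ((j : ℝ) + ((m : ℝ) - 1)) * wmax) ^ m ≤
      m.factorial * ∑ P ∈ (R.filter fun p => ¬ f p).powersetCard m, ∏ p ∈ P, w p := by
  set R' := R.filter fun p => ¬ f p with hR'
  have hsplit := Finset.sum_filter_add_sum_filter_not R f w
  have htail : ∑ p ∈ R.filter f, w p ≤ j * wmax :=
    calc ∑ p ∈ R.filter f, w p ≤ ∑ _p ∈ R.filter f, wmax :=
          Finset.sum_le_sum fun p hp => hwm p (Finset.mem_filter.mp hp).1
      _ = (R.filter f).card * wmax := by rw [Finset.sum_const, nsmul_eq_mul]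
      _ ≤ j * wmax := mul_le_mul_of_nonneg_right (by exact_mod_cast hj) hwmax
  have hw0' : ∀ p ∈ R', 0 ≤ w p := fun p hp => hw0 p (Finset.mem_filter.mp hp).1
  have hwm' : ∀ p ∈ R', w p ≤ wmax := fun p hp => hwm p (Finset.mem_filter.mp hp).1
  have hS' : ((m : ℝ) - 1) * wmax ≤ ∑ p ∈ R', w p := by nlinarith
  have h1 := pow_le_factorial_mul_esymm hw0' hwm' hwmax m hS'
  have h0 : 0 ≤ (∑ p ∈ R, w p) - ((j : ℝ) + ((m : ℝ) - 1)) * wmax := by linarith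
  have hle : (∑ p ∈ R, w p) - ((j : ℝ) + ((m : ℝ) - 1)) * wmax ≤
      (∑ p ∈ R', w p) - ((m : ℝ) - 1) * wmax := by nlinarith
  exact (pow_le_pow_left₀ h0 hle m).trans h1

/-- **Solving `(S - c)^m ≤ m! ρ` for `S`**: if `ρ ≥ 0`, `m ≥ 1` and `(S - c)^m ≤ m! ρ`
whenever `c ≤ S`, then `S ≤ m ρ^{1/m} + c` (as `m! ≤ m^m`). [folklore] -/
theorem le_of_pow_sub_le {S c ρ : ℝ} (hρ : 0 ≤ ρ) {m : ℕ} (hm : 1 ≤ m)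
    (h : c ≤ S → (S - c) ^ m ≤ m.factorial * ρ) : S ≤ m * ρ ^ (1 / (m : ℝ)) + c := by
  rcases lt_or_ge S c with hlt | hge
  · have : 0 ≤ (m : ℝ) * ρ ^ (1 / (m : ℝ)) := by positivity
    linarith
  have hm0 : (m : ℝ) ≠ 0 := by exact_mod_cast (by omega : m ≠ 0)
  have hfac : (m.factorial : ℝ) ≤ (m : ℝ) ^ m := by exact_mod_cast Nat.factorial_le_pow m
  have h2 : (S - c) ^ m ≤ ((m : ℝ) * ρ ^ (1 / (m : ℝ))) ^ m := by
    calc (S - c) ^ m ≤ m.factorial * ρ := h hge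
      _ ≤ (m : ℝ) ^ m * ρ := mul_le_mul_of_nonneg_right hfac hρ
      _ = ((m : ℝ) * ρ ^ (1 / (m : ℝ))) ^ m := by
          rw [mul_pow, ← Real.rpow_natCast (ρ ^ (1 / (m : ℝ))) m, ← Real.rpow_mul hρ,
            one_div, inv_mul_cancel₀ hm0, Real.rpow_one]
  have h3 : S - c ≤ (m : ℝ) * ρ ^ (1 / (m : ℝ)) :=
    le_of_pow_le_pow_left₀ (by omega : m ≠ 0) (by positivity) h2
  linarith

/-! ### Proposition 3.5 (3.14) -/

/-- **Tao–Teräväinen 2022, Proposition 3.5, second bound (3.14) — discharged.** For every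
`ε > 0` there are `K, η₀` (here `K = 32(4+ε) + 4`, `η₀` ineffective) such that for every
primitive quadratic `χ` mod `q`, every `η ≥ η₀` with `L(1 - 1/(η log q), χ) = 0` and every
`m ≥ 2`: `∑_{p* exceptional, q^{(1+ε)/(2m)} < p* ≤ q^{(1+ε)/(2(m-1))}} 1/p* ≤ K m/η^{1/m}`.
[cite: TaoTeravainen2021, Proposition 3.5 (3.14)] -/
theorem TaoTeravainen2021_eq314_holds : TaoTeravainen2021_eq314 := by
  intro ε hε
  -- thresholds: the engine with `ε/2`, `η ≤ q^{1/2}` ((1.4)), `q ≥ 2^{4/ε}`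
  obtain ⟨η₁, hE⟩ := exists_harmSum_ratio_le (ε := ε / 2) (half_pos hε)
  obtain ⟨η₂, hη₂⟩ := exists_eta_le_rpow (ε := 1 / 2) (by norm_num)
  obtain ⟨η₃, hη₃⟩ := exists_le_conductor ((2 : ℝ) ^ (4 / ε))
  set C₁ : ℝ := 4 * (4 + ε) with hC₁
  have hC₁1 : 1 ≤ C₁ := by rw [hC₁]; linarith
  refine ⟨8 * C₁ + 4, max (max η₁ η₂) (max η₃ 1), ?_⟩
  intro q _ χ hprim hquad η hη hL m hm
  have hηη₁ : η₁ ≤ η := ((le_max_left _ _).trans (le_max_left _ _)).trans hη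
  have hηη₂ : η₂ ≤ η := ((le_max_right _ _).trans (le_max_left _ _)).trans hη
  have hηη₃ : η₃ ≤ η := ((le_max_left _ _).trans (le_max_right _ _)).trans hη
  have hη1 : 1 ≤ η := ((le_max_right _ _).trans (le_max_right _ _)).trans hη
  have hη0 : 0 < η := by linarith
  -- the character and the conductor
  have hq2 : 2 ≤ q := two_le_of_LFunction_eq_zero hL
  have hsq : χ ^ 2 = 1 := MulChar.isQuadratic_iff_sq_eq_one.mp hquad
  have hne : χ ≠ 1 := CharacterTails.ne_one_of_isPrimitive χ hprim hq2
  have hqr : (2 : ℝ) ≤ q := by exact_mod_cast hq2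
  have hq0 : (0 : ℝ) < q := by linarith
  have hq1 : (1 : ℝ) ≤ q := by linarith
  have hηq : η ≤ (q : ℝ) ^ (1 / 2 : ℝ) := hη₂ q χ hne hsq η hηη₂ hL
  have hQq : (2 : ℝ) ^ (4 / ε) ≤ q := hη₃ q χ hne hsq η hηη₃ hL
  set l : ℝ := Real.log q with hl
  have hl2 : Real.log 2 ≤ l := Real.log_le_log two_pos hqr
  have hl23 : 2 / 3 < l := lt_of_lt_of_le (by have := Real.log_two_gt_d9; linarith) hl2
  have hl0 : 0 < l := by linarith
  -- `m` as a real number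
  have hm1 : 1 ≤ m := by omega
  have hmne : m ≠ 0 := by omega
  have hmr : (2 : ℝ) ≤ m := by exact_mod_cast hm
  have hm0 : (0 : ℝ) < m := by linarith
  have hm1r : (0 : ℝ) < (m : ℝ) - 1 := by linarith
  have hmsub : ((m - 1 : ℕ) : ℝ) = (m : ℝ) - 1 := by
    rw [Nat.cast_sub hm1, Nat.cast_one]
  -- exponents and cut-offs: `z = q^{(1+ε)/(2m)}`, `Zr = q^{(1+ε)/(2(m-1))}`, `yr = q^{(1+ε)/2}`
  set ez : ℝ := (1 + ε) / (2 * m) with hez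
  set eZ : ℝ := (1 + ε) / (2 * ((m : ℝ) - 1)) with heZ
  set eY : ℝ := (1 + ε) / 2 with heY
  have hez0 : 0 < ez := by positivity
  have heZ0 : 0 < eZ := by positivity
  have heY0 : 0 < eY := by positivity
  have hezm : ez * m = eY := by rw [hez, heY]; field_simp
  have heZm : eZ * m = eY + eZ := by
    rw [heZ, heY]; field_simp; ring
  have hez2 : ez * (2 * m + 2) = 2 * eY + 2 * ez := by
    rw [hez, heY]; field_simp
  have heZle : eZ ≤ 2 * ez := by
    have h1 : (1 + ε) / (2 * ((m : ℝ) - 1)) ≤ (1 + ε) / m :=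
      div_le_div_of_nonneg_left (by linarith) hm0 (by linarith)
    have h2 : (1 + ε) / m = 2 * ez := by rw [hez]; field_simp
    rw [heZ, ← h2]; exact h1
  have heZY : eZ ≤ eY := by
    rw [heZ, heY]
    exact div_le_div_of_nonneg_left (by linarith) two_pos (by linarith)
  set z : ℝ := (q : ℝ) ^ ez with hz
  set Zr : ℝ := (q : ℝ) ^ eZ with hZr
  set yr : ℝ := (q : ℝ) ^ eY with hyr
  set a : ℕ := ⌊z⌋₊ with ha
  set Z : ℕ := ⌊Zr⌋₊ with hZ
  set Y : ℕ := ⌊yr⌋₊ with hY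
  have hz1 : 1 ≤ z := Real.one_le_rpow hq1 hez0.le
  have hz0 : 0 < z := by linarith
  have haz : (a : ℝ) ≤ z := Nat.floor_le hz0.le
  have hza : z < (a : ℝ) + 1 := Nat.lt_floor_add_one z
  have ha1 : (0 : ℝ) < (a : ℝ) + 1 := by positivity
  have hZr1 : 1 ≤ Zr := Real.one_le_rpow hq1 heZ0.le
  have hZr0 : 0 < Zr := by linarith
  have hZZr : (Z : ℝ) ≤ Zr := Nat.floor_le hZr0.le
  have hZ1 : 1 ≤ Z := Nat.le_floor (by simpa using hZr1)
  have hZr0' : (0 : ℝ) < Z := by exact_mod_cast hZ1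
  have hyr1 : 1 ≤ yr := Real.one_le_rpow hq1 heY0.le
  have hyr0 : 0 < yr := by linarith
  have hYyr : (Y : ℝ) ≤ yr := Nat.floor_le hyr0.le
  have hyrY : yr - 1 < Y := by
    have := Nat.lt_floor_add_one yr
    linarith
  -- `z^m = yr`, `z^{2m+2} = q^{2 eY + 2 ez}`
  have hzm : z ^ m = yr := by
    rw [hz, hyr, ← Real.rpow_natCast, ← Real.rpow_mul hq0.le, hezm]
  have hz2m : z ^ (2 * m + 2) = (q : ℝ) ^ (2 * eY + 2 * ez) := by
    rw [hz, ← Real.rpow_natCast, ← Real.rpow_mul hq0.le, ← hez2]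
    norm_num
  -- `Y < (a+1)^m` and `Y Z^m < (a+1)^{2m+2}`, as naturals
  have hpow_lt : ∀ n : ℕ, n ≠ 0 → z ^ n < ((a : ℝ) + 1) ^ n := fun n hn =>
    pow_lt_pow_left₀ hza hz0.le hn
  have hYam : Y < (a + 1) ^ m := by
    have h : (Y : ℝ) < ((a : ℝ) + 1) ^ m :=
      calc (Y : ℝ) ≤ yr := hYyr
        _ = z ^ m := hzm.symm
        _ < ((a : ℝ) + 1) ^ m := hpow_lt m hmne
    exact_mod_cast h
  set U : ℕ := Y * Z ^ m with hU
  have hUr : (U : ℝ) = (Y : ℝ) * (Z : ℝ) ^ m := by rw [hU]; push_cast; ring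
  have hUle : (U : ℝ) ≤ (q : ℝ) ^ (2 * eY + 2 * ez) := by
    have h1 : (U : ℝ) ≤ yr * Zr ^ m := by
      rw [hUr]
      exact mul_le_mul hYyr (pow_le_pow_left₀ hZr0'.le hZZr m) (by positivity) hyr0.le
    have h2 : yr * Zr ^ m = (q : ℝ) ^ (eY + (eY + eZ)) := by
      rw [hyr, hZr, ← Real.rpow_natCast, ← Real.rpow_mul hq0.le, heZm, ← Real.rpow_add hq0]
    have h3 : (q : ℝ) ^ (eY + (eY + eZ)) ≤ (q : ℝ) ^ (2 * eY + 2 * ez) :=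
      Real.rpow_le_rpow_of_exponent_le hq1 (by linarith)
    exact h1.trans (h2.le.trans h3)
  have hUa : U < (a + 1) ^ (2 * m + 2) := by
    have h : (U : ℝ) < ((a : ℝ) + 1) ^ (2 * m + 2) :=
      calc (U : ℝ) ≤ (q : ℝ) ^ (2 * eY + 2 * ez) := hUle
        _ = z ^ (2 * m + 2) := hz2m.symm
        _ < ((a : ℝ) + 1) ^ (2 * m + 2) := hpow_lt (2 * m + 2) (by omega)
    exact_mod_cast h
  -- the window of primes `R = {a < p ≤ Z}` and the weight `g(n) = (1∗χ)(n)/n`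
  set R : Finset ℕ := (Ioc a Z).filter Nat.Prime with hRdef
  have hRprime : ∀ p ∈ R, p.Prime := fun p hp => (Finset.mem_filter.mp hp).2
  have hRa : ∀ p ∈ R, a < p := fun p hp => (Finset.mem_Ioc.mp (Finset.mem_filter.mp hp).1).1
  have hRZ : ∀ p ∈ R, p ≤ Z := fun p hp => (Finset.mem_Ioc.mp (Finset.mem_filter.mp hp).1).2
  set g : ArithmeticFunction ℝ := ⟨fun n => (χ.zetaMul n).re / n, by simp⟩ with hgdef
  have hg : ∀ n, g n = (χ.zetaMul n).re / n := fun n => rfl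
  have hgmul : g.IsMultiplicative := HarmWeight.isMultiplicative hsq hg
  have hg0 : ∀ n, 0 ≤ g n := HarmWeight.nonneg hsq hg
  have hgsum : ∀ s : Finset ℕ, ∑ n ∈ s, g n = ∑ n ∈ s, (χ.zetaMul n).re / n := fun s =>
    Finset.sum_congr rfl fun n _ => rfl
  -- weights on the window: `0 ≤ g(p) ≤ wmax = 2/(a+1)`
  set wmax : ℝ := 2 / ((a : ℝ) + 1) with hwmax
  have hwmax0 : 0 ≤ wmax := by positivity
  have hwR : ∀ p ∈ R, g p ≤ wmax := by
    intro p hp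
    have hpp := hRprime p hp
    have hp0 : (0 : ℝ) < p := by exact_mod_cast hpp.pos
    have hap : (a : ℝ) + 1 ≤ p := by exact_mod_cast Nat.succ_le_of_lt (hRa p hp)
    rw [HarmWeight.apply_prime hsq hg hpp]
    have hre : (χ p).re ≤ 1 := (abs_le.mp (SmoothEulerProduct.abs_apply_re_le_one χ p)).2
    calc (1 + (χ p).re) / p ≤ 2 / p := div_le_div_of_nonneg_right (by linarith) hp0.le
      _ ≤ 2 / ((a : ℝ) + 1) := div_le_div_of_nonneg_left (by norm_num) ha1 hap
  set S : ℝ := ∑ p ∈ R, g p with hSdef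
  -- Step 1: the exceptional primes of the window against `S`
  have hexc : ∑ p ∈ excPrimes χ (Ioc a Z), (1 : ℝ) / p ≤ S := by
    have hsub : excPrimes χ (Ioc a Z) ⊆ R := by
      intro p hp
      rw [mem_excPrimes] at hp
      exact Finset.mem_filter.mpr ⟨hp.1, hp.2.1⟩
    calc ∑ p ∈ excPrimes χ (Ioc a Z), (1 : ℝ) / p ≤ ∑ p ∈ excPrimes χ (Ioc a Z), g p := by
          refine Finset.sum_le_sum fun p hp => ?_
          rw [mem_excPrimes] at hp
          exact HarmWeight.one_div_le hsq hg hp.2.1 hp.2.2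
      _ ≤ S := Finset.sum_le_sum_of_subset_of_nonneg hsub fun p _ _ => hg0 p
  -- Step 2: the engine at `Y ≤ U`
  have hYlo : (q : ℝ) ^ ((1 + ε / 2) / 2) ≤ Y := by
    -- `q^{ε/4} ≥ 2`, so `yr ≥ 2 q^{(1+ε/2)/2}` and `Y > yr - 1 ≥ q^{(1+ε/2)/2}`
    have h1 : (2 : ℝ) ≤ (q : ℝ) ^ (ε / 4) := by
      have h2 : ((2 : ℝ) ^ (4 / ε)) ^ (ε / 4) ≤ (q : ℝ) ^ (ε / 4) :=
        Real.rpow_le_rpow (by positivity) hQq (by positivity)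
      rwa [← Real.rpow_mul (by norm_num : (0 : ℝ) ≤ 2),
        show 4 / ε * (ε / 4) = 1 by field_simp, Real.rpow_one] at h2
    have h3 : yr = (q : ℝ) ^ ((1 + ε / 2) / 2) * (q : ℝ) ^ (ε / 4) := by
      rw [hyr, heY, ← Real.rpow_add hq0]; ring_nf
    have h4 : 1 ≤ (q : ℝ) ^ ((1 + ε / 2) / 2) := Real.one_le_rpow hq1 (by positivity)
    have h5 : 2 * (q : ℝ) ^ ((1 + ε / 2) / 2) ≤ yr := by
      rw [h3, mul_comm]
      exact mul_le_mul_of_nonneg_left h1 (by positivity)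
    linarith
  have hYU : Y ≤ U := Nat.le_mul_of_pos_right Y (pow_pos hZ1 m)
  have hY1 : 1 ≤ Y := by
    have : (1 : ℝ) ≤ Y := (Real.one_le_rpow hq1 (by positivity)).trans hYlo
    exact_mod_cast this
  have hYr0 : (0 : ℝ) < Y := by exact_mod_cast hY1
  obtain ⟨hGYpos, hratio⟩ := hE q χ hprim hsq η hηη₁ hL Y U hYlo hYU
  set GY : ℝ := ∑ n ∈ Icc 1 Y, (χ.zetaMul n).re / n with hGYdef
  set GU : ℝ := ∑ n ∈ Icc 1 U, (χ.zetaMul n).re / n with hGUdef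
  -- `log U - log Y + 2 ≤ (4 + ε) log q`, hence `(GU - GY) η ≤ C₁ GY`
  have hlogUY : Real.log U - Real.log Y + 2 ≤ (4 + ε) * l := by
    have h1 : Real.log U = Real.log Y + m * Real.log Z := by
      rw [hUr, Real.log_mul hYr0.ne' (by positivity), Real.log_pow]
    have h2 : Real.log Z ≤ eZ * l := by
      have := Real.log_le_log hZr0' hZZr
      rwa [hZr, Real.log_rpow hq0] at this
    have h3 : (m : ℝ) * Real.log Z ≤ (eY + eZ) * l := by
      calc (m : ℝ) * Real.log Z ≤ m * (eZ * l) := mul_le_mul_of_nonneg_left h2 hm0.le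
        _ = (eZ * m) * l := by ring
        _ = (eY + eZ) * l := by rw [heZm]
    have h4 : (eY + eZ) * l ≤ (1 + ε) * l := by
      refine mul_le_mul_of_nonneg_right ?_ hl0.le
      calc eY + eZ ≤ eY + eY := by linarith
        _ = 1 + ε := by rw [heY]; ring
    have h5 : (2 : ℝ) ≤ 3 * l := by linarith
    linarith
  have hGUY : (GU - GY) * η ≤ C₁ * GY := by
    have h1 : (GU - GY) * (η * l) ≤ 4 * ((4 + ε) * l) * GY :=
      hratio.trans (mul_le_mul_of_nonneg_right
        (mul_le_mul_of_nonneg_left hlogUY (by norm_num)) hGYpos.le)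
    have h2 : (GU - GY) * η * l ≤ C₁ * GY * l := by
      calc (GU - GY) * η * l = (GU - GY) * (η * l) := by ring
        _ ≤ 4 * ((4 + ε) * l) * GY := h1
        _ = C₁ * GY * l := by rw [hC₁]; ring
    exact le_of_mul_le_mul_right h2 hl0
  have hGUY0 : 0 ≤ GU - GY := by
    have := harmSum_mono χ hsq hYU
    rw [← hGYdef, ← hGUdef] at this
    linarith
  -- Step 3: the `m`-fold products (fibre-counted) against `GU - GY`
  have hlow : ∀ P ∈ R.powersetCard m, Y < ∏ p ∈ P, p := by
    intro P hP
    obtain ⟨hPR, hcard⟩ := Finset.mem_powersetCard.mp hP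
    have h1 : (a + 1) ^ P.card ≤ ∏ p ∈ P, p :=
      Finset.pow_card_le_prod P (fun p => p) (a + 1)
        (fun p hp => Nat.succ_le_of_lt (hRa p (hPR hp)))
    rw [hcard] at h1
    exact lt_of_lt_of_le hYam h1
  have hup : ∀ n ∈ Icc 1 Y, ∀ P ∈ R.powersetCard m, n * ∏ p ∈ P, p ≤ U := by
    intro n hn P hP
    obtain ⟨hPR, hcard⟩ := Finset.mem_powersetCard.mp hP
    have h1 : ∏ p ∈ P, p ≤ Z ^ P.card :=
      Finset.prod_le_pow_card P (fun p => p) Z (fun p hp => hRZ p (hPR hp))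
    rw [hcard] at h1
    exact Nat.mul_le_mul (Finset.mem_Icc.mp hn).2 h1
  have hfew : ∀ N ∈ Ioc Y U, (R.filter (· ∣ N)).card ≤ 2 * m + 1 := by
    intro N hN
    obtain ⟨hYN, hNU⟩ := Finset.mem_Ioc.mp hN
    exact card_filter_dvd_le hRprime hRa (by omega) (lt_of_le_of_lt hNU hUa)
  have hprod := sum_mul_esymm_filter_le hgmul hg0 hRprime hlow hup hfew
  have hIoc : ∑ N ∈ Ioc Y U, g N = GU - GY := by
    rw [hgsum, hGUdef, hGYdef, harmSum_sub_harmSum χ hYU]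
  rw [hIoc] at hprod
  -- Step 4: for each `n ≤ Y`, `(S - c)^m ≤ m! e_m(g; {p ∈ R : p ∤ n})`, `c = 2(m-1) wmax`
  set c : ℝ := (((m - 1 : ℕ) : ℝ) + ((m : ℝ) - 1)) * wmax with hcdef
  have hc0 : 0 ≤ c := by rw [hcdef, hmsub]; positivity
  have hcle : c ≤ 2 * m * wmax := by
    rw [hcdef, hmsub]
    have h2 : (m : ℝ) - 1 + ((m : ℝ) - 1) ≤ 2 * m := by linarith only [hm0]
    exact mul_le_mul_of_nonneg_right h2 hwmax0
  have hpern : ∀ n ∈ Icc 1 Y, c ≤ S → (S - c) ^ m ≤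
      m.factorial * ∑ P ∈ (R.filter fun p => ¬ p ∣ n).powersetCard m, ∏ p ∈ P, g p := by
    intro n hn hcS
    have hn1 : 1 ≤ n := (Finset.mem_Icc.mp hn).1
    have hnY : n ≤ Y := (Finset.mem_Icc.mp hn).2
    have hDn : (R.filter (· ∣ n)).card ≤ m - 1 := by
      refine card_filter_dvd_le hRprime hRa hn1 ?_
      rw [Nat.sub_add_cancel hm1]
      exact lt_of_le_of_lt hnY hYam
    exact pow_sub_le_factorial_mul_esymm_filter (fun p hp => hg0 p) hwR hwmax0 (· ∣ n) hDn hcS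
  -- summing over `n` with weights `g(n)`: `GY (S - c)^m ≤ m! 2^{2m+1} (GU - GY)`
  have hsum : c ≤ S → GY * (S - c) ^ m ≤ m.factorial * (2 ^ (2 * m + 1) * (GU - GY)) := by
    intro hcS
    calc GY * (S - c) ^ m = ∑ n ∈ Icc 1 Y, (χ.zetaMul n).re / n * (S - c) ^ m := by
          rw [hGYdef, Finset.sum_mul]
      _ ≤ ∑ n ∈ Icc 1 Y, g n * (m.factorial *
            ∑ P ∈ (R.filter fun p => ¬ p ∣ n).powersetCard m, ∏ p ∈ P, g p) :=
          Finset.sum_le_sum fun n hn => by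
            rw [← hg n]
            exact mul_le_mul_of_nonneg_left (hpern n hn hcS) (hg0 n)
      _ = m.factorial * ∑ n ∈ Icc 1 Y, g n *
            ∑ P ∈ (R.filter fun p => ¬ p ∣ n).powersetCard m, ∏ p ∈ P, g p := by
          rw [Finset.mul_sum]
          refine Finset.sum_congr rfl fun n _ => ?_
          ring
      _ ≤ m.factorial * (2 ^ (2 * m + 1) * (GU - GY)) :=
          mul_le_mul_of_nonneg_left hprod (by positivity)
  -- Step 5: divide by `GY` and use the engine: `(S - c)^m ≤ m! ρ`, `ρ = 2^{2m+1} C₁/η`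
  set ρ : ℝ := 2 ^ (2 * m + 1) * C₁ / η with hρdef
  have hρ0 : 0 ≤ ρ := by positivity
  have hkey : c ≤ S → (S - c) ^ m ≤ m.factorial * ρ := by
    intro hcS
    have h1 := hsum hcS
    -- `2^{2m+1} (GU - GY) ≤ 2^{2m+1} C₁ GY/η = ρ GY`
    have h2 : 2 ^ (2 * m + 1) * (GU - GY) ≤ ρ * GY := by
      rw [hρdef]
      have h3 : GU - GY ≤ C₁ * GY / η := by
        rw [le_div_iff₀ hη0]; exact hGUY
      calc 2 ^ (2 * m + 1) * (GU - GY) ≤ 2 ^ (2 * m + 1) * (C₁ * GY / η) :=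
            mul_le_mul_of_nonneg_left h3 (by positivity)
        _ = 2 ^ (2 * m + 1) * C₁ / η * GY := by ring
    have h4 : GY * (S - c) ^ m ≤ GY * (m.factorial * ρ) := by
      calc GY * (S - c) ^ m ≤ m.factorial * (2 ^ (2 * m + 1) * (GU - GY)) := h1
        _ ≤ m.factorial * (ρ * GY) := mul_le_mul_of_nonneg_left h2 (by positivity)
        _ = GY * (m.factorial * ρ) := by ring
    exact le_of_mul_le_mul_left h4 hGYpos
  have hS : S ≤ m * ρ ^ (1 / (m : ℝ)) + c := le_of_pow_sub_le hρ0 hm1 hkey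
  -- Step 6: `ρ^{1/m} ≤ 8 C₁ η^{-1/m}` and `c ≤ 4 m η^{-1/m}` (via `η ≤ q^{1/2}`)
  set t : ℝ := η ^ (1 / (m : ℝ)) with htdef
  have ht0 : 0 < t := Real.rpow_pos_of_pos hη0 _
  have hρt : ρ ^ (1 / (m : ℝ)) ≤ 8 * C₁ / t := by
    have h1 : ρ ≤ (8 * C₁) ^ m / η := by
      rw [hρdef]
      refine div_le_div_of_nonneg_right ?_ hη0.le
      rw [mul_pow]
      refine mul_le_mul ?_ (le_self_pow₀ hC₁1 hmne) (by linarith) (by positivity)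
      calc (2 : ℝ) ^ (2 * m + 1) ≤ 2 ^ (3 * m) := pow_le_pow_right₀ (by norm_num) (by omega)
        _ = 8 ^ m := by rw [pow_mul]; norm_num
    have h2 : ρ ^ (1 / (m : ℝ)) ≤ ((8 * C₁) ^ m / η) ^ (1 / (m : ℝ)) :=
      Real.rpow_le_rpow hρ0 h1 (by positivity)
    have h3 : ((8 * C₁) ^ m / η) ^ (1 / (m : ℝ)) = 8 * C₁ / t := by
      rw [Real.div_rpow (by positivity) hη0.le, htdef, one_div,
        Real.pow_rpow_inv_natCast (by positivity) hmne]
    rw [← h3]; exact h2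
  have hct : c ≤ 4 * m / t := by
    -- `t = η^{1/m} ≤ q^{1/(2m)} ≤ z < a + 1`, so `wmax = 2/(a+1) ≤ 2/t`
    have h1 : t ≤ z := by
      have h2 : t ≤ ((q : ℝ) ^ (1 / 2 : ℝ)) ^ (1 / (m : ℝ)) :=
        Real.rpow_le_rpow hη0.le hηq (by positivity)
      have h3 : ((q : ℝ) ^ (1 / 2 : ℝ)) ^ (1 / (m : ℝ)) ≤ z := by
        rw [← Real.rpow_mul hq0.le, hz]
        refine Real.rpow_le_rpow_of_exponent_le hq1 ?_
        rw [hez, one_div_mul_one_div, div_le_div_iff_of_pos_right (by positivity)]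
        linarith
      exact h2.trans h3
    have hta : t ≤ (a : ℝ) + 1 := by linarith
    have h4 : wmax ≤ 2 / t := div_le_div_of_nonneg_left (by norm_num) ht0 hta
    calc c ≤ 2 * m * wmax := hcle
      _ ≤ 2 * m * (2 / t) := mul_le_mul_of_nonneg_left h4 (by positivity)
      _ = 4 * m / t := by ring
  -- conclusion
  calc ∑ p ∈ excPrimes χ (Ioc a Z), (1 : ℝ) / p ≤ S := hexc
    _ ≤ m * ρ ^ (1 / (m : ℝ)) + c := hS
    _ ≤ m * (8 * C₁ / t) + 4 * m / t :=
        add_le_add (mul_le_mul_of_nonneg_left hρt hm0.le) hct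
    _ = (8 * C₁ + 4) * m / t := by
        field_simp

/-! ### Corollary 3.6, first bound -/

/-- **Tao–Teräväinen 2022, Corollary 3.6, first bound — discharged**: for every `ε > 0` there
are `K, η₀` such that for every primitive quadratic `χ` mod `q`, every `η ≥ η₀` with
`L(1 - 1/(η log q), χ) = 0` and every `q^{(1+ε)/2} ≤ x ≤ q^{η^{1/2}}`,
`∑_{R₀ ≤ p* ≤ x} 1/p* ≤ K exp(-√(log η)/2)` (`R₀ = x^{1/√(log η)}`). From Proposition 3.5
(`TaoTeravainen2021_eq313_holds`, `TaoTeravainen2021_eq314_holds`) by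
`TaoTeravainen2021_cor36_i_of_prop35`. [cite: TaoTeravainen2021, Corollary 3.6 (first bound)] -/
theorem TaoTeravainen2021_cor36_i_holds : TaoTeravainen2021_cor36_i :=
  TaoTeravainen2021_cor36_i_of_prop35 TaoTeravainen2021_eq313_holds TaoTeravainen2021_eq314_holds

end Literature.NumberTheory.LFunctions.SiegelZero

end
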